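import Summits.CriticalPhenomena.Ising3D.Control2DBlockShape
import Summits.CriticalPhenomena.Ising3D.Control2DIsland
import Summits.CriticalPhenomena.Ising3D.BlockTaylorGermFamilies
import Mathlib.Analysis.SpecialFunctions.Pow.Real
import Mathlib.Tactic.Linarith
import Mathlib.Tactic.Positivity
import Mathlib.Tactic.Ring
import HarnessLib

/-!
# Taylor (derivative) functionals act termwise on the 2D sum rule — OPE convergence derived, not assumed
(cell `pub-ising3x`, seat controls-1 gen 14; KERNEL PATH for the 2D γ (derivative-functional)
certificates, step 1b — CONTROL-ONLY)

HONEST FRAMING: lottery ticket; floor = tightest certified 3D Ising CFT bounds; no exact-solution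
claim without a proof. CONTROL-ONLY (`d = 2`); nothing numerical is asserted here.

The 2D control's typed statements (`GapExcluded`, `OpeBound`, `BoxExcluded`/`ExcludedAt`,
`OpeUpper/LowerA2D`, `OpeEpsUpper/LowerA2D`) quantify over `CrossingData` satisfying 2D unitarity and
the `⟨σσσσ⟩` sum rule as a pointwise `HasSum` on the open square — NO separate OPE-convergence axiom
(unlike the 3D `SatisfiesBootstrapAxioms`, whose clause A1 `HasConvergentWeights` feeds boot-1's
`hasSummableGerms_gp`). Point functionals need none. A DERIVATIVE functional (boot-1's typed form:
`IsTaylorFunctional x x φ`, a finite combination of Taylor coefficients at the diagonal point `(x,x)`)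
acts termwise only under an M-test (`IsTaylorFunctional.hasSum_mul_of_hasSummableGerms`), i.e. needs
`∑ p_i g_i(X,X) < ∞` at two diagonal points. THIS FILE DERIVES that convergence inside each typed
statement's contradiction branch and concludes termwise action:

* `summable_diag_of_summable_crossF` — the sign argument: if every exchanged `(Δ_i, ℓ_i)` has
  `Δ_i ≥ τ₀ > 2s` (`s = Δ_σ`), then at a diagonal point `x < 1/2` EVERY sum-rule term satisfies
  `p_i F_-[g_i](x,x) ≤ -c · p_i g_i(1-x,1-x)` with `c = diagConst s τ₀ x > 0`
  (`crossF_globalBlock_diag_le`); a `HasSum` over a real family is unconditional, hence the terms are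
  (absolutely) summable, hence `∑ p_i g_i(y,y) < ∞` for every `y ∈ (1/2,1)` and, by monotonicity, for
  every `y ∈ (0,1)` (`summable_diag_all`). For the gap statements this needs `U > 2Δ_σ` (and
  `Δ_σ < 1` for the spinning operators, `Δ ≥ ℓ ≥ 2`); for the box / ope kinds `e₁ > 2Δ_σ`, `G > 2Δ_σ`.
* `hasSummableGerms_globalBlock_family` — with `globalBlock_eq_shape` (the 2D block is of the 3D
  chain's block shape) boot-1's `hasSummableGerms_of_blockShape` applies verbatim.
* `hasSum_taylor_family`, `CrossingData.hasSum_taylor_of_lowerBound/_of_hasScalarGap/_of_scalarsIn` —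
  **termwise action**: `∑ p_i φ(F_-[g_i]) = -φ(F_-[1])` (`HasSum`) for every Taylor functional at a
  diagonal point of the square.
* `CrossingData.hasSum_taylor_of_location` — the SINGLE-LOCATION data of `ExcludedAt`/`TwoSided`
  (scalars in `{x₀} ∪ [G,∞)`) need NO condition on `x₀`: either the weights at `x₀` are summable (then
  the above applies with the `x₀`-block entered once), or they are not, and then the crossing term
  `F_-[g_{x₀,0}]` vanishes identically on the square (a non-summable family times a non-zero constant
  is not summable), so a Taylor functional kills it (`IsTaylorFunctional.map_eq_zero_of_eqOn`) and the
  datum with the `x₀`-scalars erased still satisfies the sum rule.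

What is NOT here: the soundness twins themselves (`Control2DTaylorSound.lean`), the termwise reduction
of the above-threshold obligation for one block (`Control2DTaylorPairs.lean`), any certificate, any
closed form of a Taylor coefficient of a block. Sources: R. Rattazzi, V. S. Rychkov, E. Tonni, A. Vichi,
JHEP 12 (2008) 031, §3–§5 (sum rule, linear functionals); D. Pappadopulo, S. Rychkov, J. Espin,
R. Rattazzi, Phys. Rev. D 86 (2012) 105043, §4 (OPE convergence — here a CONSEQUENCE of the typed
hypotheses, not an input); boot-1's `TaylorFunctional` / `BlockTaylorGerm(Families)` (tree).
-/

namespace Summit.CriticalPhenomena.Ising3D.Control2D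

open Set
open Literature.MathematicalPhysics.QuantumFieldTheory.ConformalBootstrap3D

/-! ### Lower bounds on the exchanged dimensions from the typed hypotheses -/

namespace CrossingData

/-- Under 2D unitarity (even spins, `Δ ≥ ℓ`) a non-scalar quasi-primary has `Δ ≥ 2`. [folklore] -/
theorem two_le_of_spin_ne_zero {D : CrossingData} (hU : D.IsUnitary) {i : D.ι} (h0 : D.spin i ≠ 0) :
    (2 : ℝ) ≤ D.Δ i := by
  obtain ⟨hev, hΔℓ, -⟩ := hU i
  obtain ⟨k, hk⟩ := hev
  have h2 : 2 ≤ D.spin i := by omega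
  have : (2 : ℝ) ≤ (D.spin i : ℝ) := by exact_mod_cast h2
  linarith

/-- A scalar gap `U` gives the uniform lower bound `min U 2` on every exchanged dimension. [folklore] -/
theorem lowerBound_of_hasScalarGap {D : CrossingData} (hU : D.IsUnitary) {U : ℝ}
    (hgap : D.HasScalarGap U) (i : D.ι) : min U 2 ≤ D.Δ i := by
  by_cases h0 : D.spin i = 0
  · exact (min_le_left _ _).trans (hgap i h0)
  · exact (min_le_right _ _).trans (two_le_of_spin_ne_zero hU h0)

/-- The `A2D′` scalar hypothesis "scalars in `[e₁,e₂] ∪ [G,∞)`" gives the uniform lower bound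
`min (min e₁ G) 2`. [folklore] -/
theorem lowerBound_of_scalarsIn {D : CrossingData} (hU : D.IsUnitary) {e₁ e₂ G : ℝ}
    (hS : D.ScalarsIn (Icc e₁ e₂ ∪ Ici G)) (i : D.ι) : min (min e₁ G) 2 ≤ D.Δ i := by
  by_cases h0 : D.spin i = 0
  · rcases hS i h0 with hbox | hG
    · exact (min_le_left _ _).trans ((min_le_left _ _).trans hbox.1)
    · exact (min_le_left _ _).trans ((min_le_right _ _).trans hG)
  · exact (min_le_right _ _).trans (two_le_of_spin_ne_zero hU h0)

end CrossingData

/-! ### OPE convergence on the diagonal, derived from the sum rule -/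

/-- **The sign argument.** For a family of unitary blocks (`ℓ_i ≤ Δ_i`, weights `p_i ≥ 0`) all of
dimension `Δ_i ≥ τ₀ > 2s`, summability of the sum-rule terms `p_i F^{s}_-[g_i](x,x)` at a diagonal
point `0 < x < 1/2` gives `∑ p_i g_i(1-x,1-x) < ∞`: each term is `≤ -c · p_i g_i(1-x,1-x)` with
`c = diagConst s τ₀ x > 0`. [cite: RattazziEtAl2008, §3] -/
theorem summable_diag_of_summable_crossF {ι : Type*} {Δ : ι → ℝ} {spin : ι → ℕ} {p : ι → ℝ}
    {s τ₀ x : ℝ} (hunit : ∀ i, (spin i : ℝ) ≤ Δ i) (hp : ∀ i, 0 ≤ p i) (hτ : ∀ i, τ₀ ≤ Δ i)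
    (hτ₀ : 2 * s < τ₀) (hx0 : 0 < x) (hx2 : x < 1 / 2)
    (hsum : Summable fun i => p i * crossF s (-1) (globalBlock (Δ i) (spin i)) x x) :
    Summable fun i => p i * globalBlock (Δ i) (spin i) (1 - x) (1 - x) := by
  have hc := diagConst_pos hτ₀ hx0 hx2
  have h1x : (1 - x) ∈ Ioo (0 : ℝ) 1 := ⟨by linarith, by linarith⟩
  have hle : ∀ i, diagConst s τ₀ x * (p i * globalBlock (Δ i) (spin i) (1 - x) (1 - x)) ≤
      -(p i * crossF s (-1) (globalBlock (Δ i) (spin i)) x x) := by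
    intro i
    have h := mul_le_mul_of_nonneg_left
      (crossF_globalBlock_diag_le (s := s) (hunit i) (hτ i) hx0 hx2.le) (hp i)
    have h2 : p i * (-(diagConst s τ₀ x) * globalBlock (Δ i) (spin i) (1 - x) (1 - x)) =
        -(diagConst s τ₀ x * (p i * globalBlock (Δ i) (spin i) (1 - x) (1 - x))) := by ring
    linarith
  have hnn : ∀ i, 0 ≤ diagConst s τ₀ x * (p i * globalBlock (Δ i) (spin i) (1 - x) (1 - x)) :=
    fun i => mul_nonneg hc.le (mul_nonneg (hp i) (globalBlock_diag_nonneg (hunit i) h1x))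
  have hS : Summable fun i => diagConst s τ₀ x * (p i * globalBlock (Δ i) (spin i) (1 - x) (1 - x)) :=
    hsum.neg.of_nonneg_of_le hnn hle
  refine (hS.mul_left (diagConst s τ₀ x)⁻¹).congr fun i => ?_
  rw [inv_mul_cancel_left₀ hc.ne']

/-- Monotone transfer on the diagonal: summability at `y'` gives summability at `y ≤ y'`. [folklore] -/
theorem summable_diag_mono {ι : Type*} {Δ : ι → ℝ} {spin : ι → ℕ} {p : ι → ℝ} {y y' : ℝ}
    (hunit : ∀ i, (spin i : ℝ) ≤ Δ i) (hp : ∀ i, 0 ≤ p i) (hy : 0 < y) (hyy' : y ≤ y')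
    (hy' : y' < 1) (h : Summable fun i => p i * globalBlock (Δ i) (spin i) y' y') :
    Summable fun i => p i * globalBlock (Δ i) (spin i) y y :=
  h.of_nonneg_of_le
    (fun i => mul_nonneg (hp i) (globalBlock_diag_nonneg (hunit i) ⟨hy, lt_of_le_of_lt hyy' hy'⟩))
    (fun i => mul_le_mul_of_nonneg_left (globalBlock_diag_mono (hunit i) hy hyy' hy') (hp i))

/-- From summability at every mirror point `1 - x`, `x ∈ (0, 1/2)`, to summability at every diagonal
point of the square (points `y ≤ 1/2` by comparison with `y' = 3/4`). [folklore] -/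
theorem summable_diag_all {ι : Type*} {Δ : ι → ℝ} {spin : ι → ℕ} {p : ι → ℝ}
    (hunit : ∀ i, (spin i : ℝ) ≤ Δ i) (hp : ∀ i, 0 ≤ p i)
    (h : ∀ x : ℝ, 0 < x → x < 1 / 2 →
      Summable fun i => p i * globalBlock (Δ i) (spin i) (1 - x) (1 - x))
    {y : ℝ} (hy : y ∈ Ioo (0 : ℝ) 1) : Summable fun i => p i * globalBlock (Δ i) (spin i) y y := by
  rcases lt_or_ge (1 / 2 : ℝ) y with hgt | hle
  · have h1 := h (1 - y) (by linarith [hy.2]) (by linarith)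
    simpa only [sub_sub_cancel] using h1
  · have h34 := h (1 / 4) (by norm_num) (by norm_num)
    norm_num at h34
    exact summable_diag_mono hunit hp hy.1 (by linarith) (by norm_num) h34

/-- **OPE convergence on the diagonal from the sum rule**: for a family of unitary blocks with
`Δ_i ≥ τ₀ > 2s` satisfying the `⟨σσσσ⟩` sum rule at `Δ_σ = s` pointwise on the square (only summability of
the terms at diagonal points is used), `∑ p_i g_i(y,y) < ∞` at every `0 < y < 1`.
[cite: RattazziEtAl2008, §3] -/
theorem summable_diag_of_lowerBound {ι : Type*} {Δ : ι → ℝ} {spin : ι → ℕ} {p : ι → ℝ}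
    {s τ₀ : ℝ} (hunit : ∀ i, (spin i : ℝ) ≤ Δ i) (hp : ∀ i, 0 ≤ p i) (hτ : ∀ i, τ₀ ≤ Δ i)
    (hτ₀ : 2 * s < τ₀)
    (hcross : ∀ x : ℝ, 0 < x → x < 1 / 2 →
      Summable fun i => p i * crossF s (-1) (globalBlock (Δ i) (spin i)) x x)
    {y : ℝ} (hy : y ∈ Ioo (0 : ℝ) 1) : Summable fun i => p i * globalBlock (Δ i) (spin i) y y :=
  summable_diag_all hunit hp
    (fun x hx0 hx2 => summable_diag_of_summable_crossF hunit hp hτ hτ₀ hx0 hx2 (hcross x hx0 hx2)) hy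

/-! ### Summable germs and termwise action -/

/-- **Summable Taylor germs of the 2D sum-rule family.** For unitary blocks with weights `p_i ≥ 0`
whose diagonal values are summable at every point of the square, the family `F^{s}_-[g_i]` has
summable germs at every diagonal point `(x,x)` with any majorant radius `ρ < x(1-x)` — boot-1's
`hasSummableGerms_of_blockShape` on the block shape `globalBlock_eq_shape`, the two majorant values
being `g_i(X₁,X₁)`, `g_i(X₂,X₂)` (`rpow_mul_tsum_abs_eq`, non-negative array). [folklore] -/
theorem hasSummableGerms_globalBlock_family {ι : Type*} {Δ : ι → ℝ} {spin : ι → ℕ} {p : ι → ℝ}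
    (hunit : ∀ i, (spin i : ℝ) ≤ Δ i) (hp : ∀ i, 0 ≤ p i) (s : ℝ)
    (hsum : ∀ y : ℝ, y ∈ Ioo (0 : ℝ) 1 → Summable fun i => p i * globalBlock (Δ i) (spin i) y y)
    {x ρ : ℝ} (hx0 : 0 < x) (hx1 : x < 1) (hρ0 : 0 < ρ) (hρ : ρ < x * (1 - x)) :
    HasSummableGerms p (fun i => crossF s (-1) (globalBlock (Δ i) (spin i))) x x ρ := by
  have hX₁ := bgX₁_pos_lt hx0 hρ
  have hX₂ := bgX₂_pos_lt hx1 hρ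
  refine hasSummableGerms_of_blockShape p (fun i => globalBlock (Δ i) (spin i)) s (-1) hx0 hx1 hρ0 hρ
    (fun i => gbCoeff (Δ i) (spin i)) (fun i => gbSeries (Δ i) (spin i))
    (fun i => (Δ i - spin i) / 2)
    (fun i => isDoublePowerSeriesOn_gbSeries (hunit i))
    (fun i => by have := hunit i; linarith)
    (fun i z zb hz hzb => globalBlock_eq_shape (hunit i) hz hzb)
    (fun i => globalBlock (Δ i) (spin i) (bgX₁ x ρ) (bgX₁ x ρ))
    (fun i => globalBlock (Δ i) (spin i) (bgX₂ x ρ) (bgX₂ x ρ))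
    (fun i => le_of_eq ?_) (fun i => le_of_eq ?_) ?_ ?_
  · rw [rpow_mul_tsum_abs_eq (isDoublePowerSeriesOn_gbSeries (hunit i)) (gbCoeff_nonneg (hunit i))
        _ hX₁.1 hX₁.2, ← globalBlock_eq_shape (hunit i) hX₁ hX₁]
  · rw [rpow_mul_tsum_abs_eq (isDoublePowerSeriesOn_gbSeries (hunit i)) (gbCoeff_nonneg (hunit i))
        _ hX₂.1 hX₂.2, ← globalBlock_eq_shape (hunit i) hX₂ hX₂]
  · exact (hsum _ hX₁).congr fun i => by rw [abs_of_nonneg (hp i)]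
  · exact (hsum _ hX₂).congr fun i => by rw [abs_of_nonneg (hp i)]

/-- **Termwise action of a Taylor functional on the 2D sum rule** (family form): for unitary blocks
with weights `p_i ≥ 0` satisfying the sum rule `∑ p_i F_-[g_i] = -F_-[1]` pointwise on the square and
with summable diagonal values, every Taylor functional `φ` at a diagonal point `(x,x)`, `0 < x < 1`,
gives `∑ p_i φ(F_-[g_i]) = -φ(F_-[1])` (`HasSum`). The M-test on germs
(`IsTaylorFunctional.hasSum_mul_of_hasSummableGerms`) with radius `x(1-x)/2`.
[cite: RattazziEtAl2008, §5] -/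
theorem hasSum_taylor_family {ι : Type*} {Δ : ι → ℝ} {spin : ι → ℕ} {p : ι → ℝ} {s x : ℝ}
    {φ : (ℝ → ℝ → ℝ) →ₗ[ℝ] ℝ} (hφ : IsTaylorFunctional x x φ) (hx0 : 0 < x) (hx1 : x < 1)
    (hunit : ∀ i, (spin i : ℝ) ≤ Δ i) (hp : ∀ i, 0 ≤ p i)
    (hcross : ∀ z zb : ℝ, z ∈ Ioo (0 : ℝ) 1 → zb ∈ Ioo (0 : ℝ) 1 →
      HasSum (fun i => p i * crossF s (-1) (globalBlock (Δ i) (spin i)) z zb)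
        (-(crossF s (-1) (fun _ _ => (1 : ℝ)) z zb)))
    (hsum : ∀ y : ℝ, y ∈ Ioo (0 : ℝ) 1 → Summable fun i => p i * globalBlock (Δ i) (spin i) y y) :
    HasSum (fun i => p i * φ (crossF s (-1) (globalBlock (Δ i) (spin i))))
      (-(φ (crossF s (-1) (fun _ _ => (1 : ℝ))))) := by
  have hr : 0 < x * (1 - x) := mul_pos hx0 (by linarith)
  have hρ0 : 0 < x * (1 - x) / 2 := by positivity
  have hρ : x * (1 - x) / 2 < x * (1 - x) := by linarith
  have hG := hasSummableGerms_globalBlock_family hunit hp s hsum hx0 hx1 hρ0 hρ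
  have hs := hφ.hasSum_mul_of_hasSummableGerms hρ0 hG
    (fun z zb => -(crossF s (-1) (fun _ _ => (1 : ℝ)) z zb)) (fun h k hh hk =>
      hcross (x + h) (x + k) (mem_Ioo_of_abs_lt (hh.trans hρ)) (mem_Ioo_of_abs_lt (hk.trans hρ)))
  have hneg : φ (fun z zb => -(crossF s (-1) (fun _ _ => (1 : ℝ)) z zb))
      = -(φ (crossF s (-1) (fun _ _ => (1 : ℝ)))) := by
    rw [← map_neg]; rfl
  rw [hneg] at hs
  exact hs

namespace CrossingData

variable {D : CrossingData} {s x : ℝ} {φ : (ℝ → ℝ → ℝ) →ₗ[ℝ] ℝ}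

/-- **Termwise action under a uniform lower bound `Δ_i ≥ τ₀ > 2Δ_σ`.** A unitary crossing datum all
of whose exchanged dimensions exceed `2s` has absolutely convergent OPE on the diagonal
(`summable_diag_of_lowerBound`), so every Taylor functional at `(x,x)` acts termwise on its sum rule.
[cite: RattazziEtAl2008, §5] -/
theorem hasSum_taylor_of_lowerBound (hφ : IsTaylorFunctional x x φ) (hx0 : 0 < x) (hx1 : x < 1)
    (hU : D.IsUnitary) (hC : D.SatisfiesCrossing s) {τ₀ : ℝ} (hτ : ∀ i, τ₀ ≤ D.Δ i)
    (hτ₀ : 2 * s < τ₀) :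
    HasSum (fun i => D.p i * φ (crossF s (-1) (globalBlock (D.Δ i) (D.spin i))))
      (-(φ (crossF s (-1) (fun _ _ => (1 : ℝ))))) :=
  hasSum_taylor_family hφ hx0 hx1 (fun i => (hU i).2.1) (fun i => (hU i).2.2) hC
    (fun _ hy => summable_diag_of_lowerBound (fun i => (hU i).2.1) (fun i => (hU i).2.2) hτ hτ₀
      (fun x' hx0' hx2' => (hC x' x' ⟨hx0', by linarith⟩ ⟨hx0', by linarith⟩).summable) hy)

/-- **Termwise action in the branch of a gap statement**: scalar gap `U > 2s` and `s < 1` (so that the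
spinning operators, `Δ ≥ ℓ ≥ 2`, are above `2s` too). [cite: RattazziEtAl2008, §5] -/
theorem hasSum_taylor_of_hasScalarGap (hφ : IsTaylorFunctional x x φ) (hx0 : 0 < x) (hx1 : x < 1)
    (hU : D.IsUnitary) (hC : D.SatisfiesCrossing s) {U : ℝ} (hgap : D.HasScalarGap U)
    (hU2 : 2 * s < U) (hs1 : s < 1) :
    HasSum (fun i => D.p i * φ (crossF s (-1) (globalBlock (D.Δ i) (D.spin i))))
      (-(φ (crossF s (-1) (fun _ _ => (1 : ℝ))))) :=
  hasSum_taylor_of_lowerBound hφ hx0 hx1 hU hC (lowerBound_of_hasScalarGap hU hgap)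
    (lt_min hU2 (by linarith))

/-- **Termwise action in the branch of an `A2D′` box statement**: scalars in `[e₁,e₂] ∪ [G,∞)` with
`e₁ > 2s`, `G > 2s`, `s < 1`. [cite: RattazziEtAl2008, §5] -/
theorem hasSum_taylor_of_scalarsIn (hφ : IsTaylorFunctional x x φ) (hx0 : 0 < x) (hx1 : x < 1)
    (hU : D.IsUnitary) (hC : D.SatisfiesCrossing s) {e₁ e₂ G : ℝ}
    (hS : D.ScalarsIn (Icc e₁ e₂ ∪ Ici G)) (he : 2 * s < e₁) (hG : 2 * s < G) (hs1 : s < 1) :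
    HasSum (fun i => D.p i * φ (crossF s (-1) (globalBlock (D.Δ i) (D.spin i))))
      (-(φ (crossF s (-1) (fun _ _ => (1 : ℝ))))) :=
  hasSum_taylor_of_lowerBound hφ hx0 hx1 hU hC (lowerBound_of_scalarsIn hU hS)
    (lt_min (lt_min he hG) (by linarith))

/-- **Termwise action for single-location data, no condition on the location.** If the scalars of a
unitary crossing datum lie in `{x₀} ∪ [G,∞)` with `G > 2s`, `s < 1`, then every Taylor functional at a
diagonal point acts termwise on its sum rule. Dichotomy: if the weights of the scalars at `x₀` are
summable, the diagonal OPE converges (the `x₀`-block contributes `(∑ p) g_{x₀}(y,y)`, the rest by the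
sign argument) and `hasSum_taylor_family` applies; if not, the constant `F_-[g_{x₀,0}](z,z̄)` must
vanish at every point of the square (a sub-family of a summable real family is summable), so `φ` kills
the `x₀`-terms (`IsTaylorFunctional.map_eq_zero_of_eqOn`) and the datum with those terms erased still
satisfies the sum rule with all dimensions `≥ min G 2 > 2s`. [cite: RattazziEtAl2008, §5] -/
theorem hasSum_taylor_of_location (hφ : IsTaylorFunctional x x φ) (hx0 : 0 < x) (hx1 : x < 1)
    (hU : D.IsUnitary) (hC : D.SatisfiesCrossing s) {x₀ G : ℝ}
    (hS : D.ScalarsIn ({x₀} ∪ Ici G)) (hG : 2 * s < G) (hs1 : s < 1) :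
    HasSum (fun i => D.p i * φ (crossF s (-1) (globalBlock (D.Δ i) (D.spin i))))
      (-(φ (crossF s (-1) (fun _ _ => (1 : ℝ))))) := by
  have hτ₀ : 2 * s < min G 2 := lt_min hG (by linarith)
  have hoff : ∀ i : D.ι, ¬ (D.spin i = 0 ∧ D.Δ i = x₀) → min G 2 ≤ D.Δ i := by
    intro i hi
    by_cases h0 : D.spin i = 0
    · rcases hS i h0 with hx | hG'
      · exact (hi ⟨h0, mem_singleton_iff.mp hx⟩).elim
      · exact (min_le_left _ _).trans hG'
    · exact (min_le_right _ _).trans (two_le_of_spin_ne_zero hU h0)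
  -- the complement family
  have hunit' : ∀ i : ↥({i : D.ι | D.spin i = 0 ∧ D.Δ i = x₀} : Set D.ι)ᶜ,
      ((D.spin i : ℕ) : ℝ) ≤ D.Δ i := fun i => (hU i).2.1
  have hp' : ∀ i : ↥({i : D.ι | D.spin i = 0 ∧ D.Δ i = x₀} : Set D.ι)ᶜ, 0 ≤ D.p i :=
    fun i => (hU i).2.2
  have hτ' : ∀ i : ↥({i : D.ι | D.spin i = 0 ∧ D.Δ i = x₀} : Set D.ι)ᶜ, min G 2 ≤ D.Δ i :=
    fun i => hoff i i.2
  by_cases hB : Summable fun i : ↥({i : D.ι | D.spin i = 0 ∧ D.Δ i = x₀} : Set D.ι) => D.p i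
  · -- Case A: the diagonal OPE converges everywhere
    refine hasSum_taylor_family hφ hx0 hx1 (fun i => (hU i).2.1) (fun i => (hU i).2.2) hC
      fun y hy => ?_
    refine (summable_subtype_and_compl (s := ({i : D.ι | D.spin i = 0 ∧ D.Δ i = x₀} : Set D.ι))).mp
      ⟨?_, ?_⟩
    · refine (hB.mul_right (globalBlock x₀ 0 y y)).congr fun i => ?_
      have hi : D.spin i.1 = 0 ∧ D.Δ i.1 = x₀ := i.2
      rw [hi.1, hi.2]
    · exact summable_diag_all hunit' hp' (fun x' hx0' hx2' =>
        summable_diag_of_summable_crossF hunit' hp' hτ' hτ₀ hx0' hx2'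
          ((hC x' x' ⟨hx0', by linarith⟩ ⟨hx0', by linarith⟩).summable.subtype _)) hy
  · -- Case B: the `x₀` crossing term vanishes identically on the square
    have hzero : ∀ z zb : ℝ, z ∈ Ioo (0 : ℝ) 1 → zb ∈ Ioo (0 : ℝ) 1 →
        crossF s (-1) (globalBlock x₀ 0) z zb = 0 := by
      intro z zb hz hzb
      by_contra hne
      apply hB
      have h2 : Summable fun i : ↥({i : D.ι | D.spin i = 0 ∧ D.Δ i = x₀} : Set D.ι) =>
          D.p i * crossF s (-1) (globalBlock x₀ 0) z zb := by
        refine ((hC z zb hz hzb).summable.subtype _).congr fun i => ?_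
        have hi : D.spin i.1 = 0 ∧ D.Δ i.1 = x₀ := i.2
        simp only [Function.comp_apply]
        rw [hi.1, hi.2]
      refine (h2.mul_right (crossF s (-1) (globalBlock x₀ 0) z zb)⁻¹).congr fun i => ?_
      rw [mul_inv_cancel_right₀ hne]
    have hr : 0 < x * (1 - x) := mul_pos hx0 (by linarith)
    have hφzero : ∀ i : D.ι, (D.spin i = 0 ∧ D.Δ i = x₀) →
        D.p i * φ (crossF s (-1) (globalBlock (D.Δ i) (D.spin i))) = 0 := by
      intro i hi
      rw [hi.2, hi.1, hφ.map_eq_zero_of_eqOn hr (fun h k hh hk =>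
        hzero _ _ (mem_Ioo_of_abs_lt hh) (mem_Ioo_of_abs_lt hk)), mul_zero]
    have hsupp : Function.support
        (fun i => D.p i * φ (crossF s (-1) (globalBlock (D.Δ i) (D.spin i)))) ⊆
        ({i : D.ι | D.spin i = 0 ∧ D.Δ i = x₀} : Set D.ι)ᶜ := by
      intro i hi hmem
      exact hi (hφzero i hmem)
    refine (hasSum_subtype_iff_of_support_subset hsupp).mp ?_
    have hcross' : ∀ z zb : ℝ, z ∈ Ioo (0 : ℝ) 1 → zb ∈ Ioo (0 : ℝ) 1 →
        HasSum (fun i : ↥({i : D.ι | D.spin i = 0 ∧ D.Δ i = x₀} : Set D.ι)ᶜ =>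
          D.p i * crossF s (-1) (globalBlock (D.Δ i) (D.spin i)) z zb)
          (-(crossF s (-1) (fun _ _ => (1 : ℝ)) z zb)) := by
      intro z zb hz hzb
      refine (hasSum_subtype_iff_of_support_subset ?_).mpr (hC z zb hz hzb)
      intro i hi hmem
      apply hi
      have hmem' : D.spin i = 0 ∧ D.Δ i = x₀ := hmem
      simp only [hmem'.1, hmem'.2, hzero z zb hz hzb, mul_zero]
    exact hasSum_taylor_family hφ hx0 hx1 hunit' hp' hcross'
      (fun y hy => summable_diag_all hunit' hp' (fun x' hx0' hx2' =>
        summable_diag_of_summable_crossF hunit' hp' hτ' hτ₀ hx0' hx2'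
          (hcross' x' x' ⟨hx0', by linarith⟩ ⟨hx0', by linarith⟩).summable) hy)

end CrossingData

end Summit.CriticalPhenomena.Ising3D.Control2D
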